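import Mathlib.Analysis.InnerProductSpace.Adjoint
import Mathlib.Analysis.Calculus.FDeriv.Prod
import Mathlib.Analysis.Calculus.FDeriv.Linear
import Mathlib.Analysis.Calculus.Deriv.Comp
import Mathlib.Analysis.Calculus.Deriv.Add
import Mathlib.Analysis.Calculus.Deriv.Prod
import HarnessLib

/-!
# Normal velocity of a moving graph (White 2005, §8.4)

Topic `Literature/Geometry/Riemannian` (companion of `GraphNormalVelocity.lean`, here in the
convention of the tree's `K_{2,α}` machinery, `FlowC2AlphaNorm.lean`: parameter space `E'`, a
linear isometry `L : E' →ₗᵢ V` onto the "horizontal" plane `K = range L`, graph map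
`x ↦ L x + u(x, t)` with `u ⊥ K`).

* `normalPart_velocity_eq` — if a curve `γ` on the moving graph, `γ t = L (ξ t) + U (ξ t, t)`
  near `t₀` with `ξ` differentiable at `t₀` and `U` (jointly) differentiable at `(ξ t₀, t₀)` with
  differential `U'`, has velocity `v` at `t₀`, then `v - w ∈ T` for the vertical velocity
  `w = U'(0, 1) = ∂ₜu` and the tangent space `T = range (L + D)`, `D = U'(·, 0) = Du`; hence the
  NORMAL velocity is `P_{Tᗮ} v = P_{Tᗮ} w`, and `v = P_{Tᗮ} w` when `v ⊥ T` (mean curvature flow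
  moves points normally).
* `vertical_eq_of_normalPart` — White's identity `(11)`/`(12)` on p. 1505: for `w ⊥ K` and
  `D` with values `⊥ K`, writing `β = w - P_T w` (the normal part),
  `w = P_{Kᗮ} β - D (L† β)` (`L†` the adjoint, `= L⁻¹ ∘ P_K`), i.e. `∂ₜu = π′β - Du(πβ)`.

Everything is PROVED; no definitions, no named facts.

## References

* B. White, *A local regularity theorem for mean curvature flow*, Ann. of Math. 161 (2005),
  §8.4, p. 1505 (11)–(12). [White2005]
-/

noncomputable section

namespace Literature.Geometry.Riemannian

open Submodule
open scoped RealInnerProductSpace Topology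

variable {E' V : Type*} [NormedAddCommGroup E'] [InnerProductSpace ℝ E'] [FiniteDimensional ℝ E']
  [NormedAddCommGroup V] [InnerProductSpace ℝ V] [FiniteDimensional ℝ V]

omit [FiniteDimensional ℝ E'] [FiniteDimensional ℝ V] in
/-- **Velocity of a curve on a moving graph modulo the tangent space.**  If
`γ t = L (ξ t) + U (ξ t, t)` for `t` near `t₀`, `ξ` has derivative `ξ'` at `t₀`, `U` has (joint)
differential `U'` at `(ξ t₀, t₀)` and `γ` has derivative `v` at `t₀`, then
`v - U' (0, 1) = (L + U'(·, 0)) ξ' ∈ range (L + U'(·, 0))`. [cite: White2005, §8.4] -/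
theorem velocity_sub_vertical_mem_range (L : E' →L[ℝ] V) {U : E' × ℝ → V} {U' : E' × ℝ →L[ℝ] V}
    {γ : ℝ → V} {ξ : ℝ → E'} {ξ' : E'} {v : V} {t₀ : ℝ}
    (hγ : ∀ᶠ t in 𝓝 t₀, γ t = L (ξ t) + U (ξ t, t)) (hξ : HasDerivAt ξ ξ' t₀)
    (hU : HasFDerivAt U U' (ξ t₀, t₀)) (hv : HasDerivAt γ v t₀) :
    v - U' (0, 1) ∈
      LinearMap.range ((L : E' →ₗ[ℝ] V) + (U' : E' × ℝ →ₗ[ℝ] V) ∘ₗ LinearMap.inl ℝ E' ℝ) := by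
  -- derivative of the right-hand side
  have h1 : HasDerivAt (fun t => (ξ t, t)) (ξ', 1) t₀ := hξ.prodMk (hasDerivAt_id t₀)
  have h2 : HasDerivAt (fun t => U (ξ t, t)) (U' (ξ', 1)) t₀ :=
    hU.comp_hasDerivAt_of_eq t₀ h1 rfl
  have h3 : HasDerivAt (fun t => L (ξ t)) (L ξ') t₀ := L.hasFDerivAt.comp_hasDerivAt t₀ hξ
  have h4 : HasDerivAt (fun t => L (ξ t) + U (ξ t, t)) (L ξ' + U' (ξ', 1)) t₀ :=
    HasDerivAt.add h3 h2
  have h5 : HasDerivAt γ (L ξ' + U' (ξ', 1)) t₀ := h4.congr_of_eventuallyEq hγ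
  have hv' : v = L ξ' + U' (ξ', 1) := hv.unique h5
  have hsplit : U' (ξ', 1) = U' (ξ', 0) + U' (0, 1) := by
    rw [← map_add]; simp
  refine ⟨ξ', ?_⟩
  simp only [LinearMap.add_apply, LinearMap.coe_comp, Function.comp_apply, LinearMap.inl_apply,
    ContinuousLinearMap.coe_coe]
  rw [hv', hsplit]; abel

omit [FiniteDimensional ℝ V] in
/-- **The normal velocity of a moving graph is the normal part of the vertical velocity**:
under the hypotheses of `velocity_sub_vertical_mem_range`, with `T = range (L + U'(·, 0))`,
`P_{Tᗮ} v = P_{Tᗮ} (U'(0, 1))`; if the velocity is normal (`v ∈ Tᗮ`) then `v = P_{Tᗮ} (U'(0,1))`.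
[cite: White2005, §8.4] -/
theorem normalPart_velocity_eq (L : E' →L[ℝ] V) {U : E' × ℝ → V} {U' : E' × ℝ →L[ℝ] V}
    {γ : ℝ → V} {ξ : ℝ → E'} {ξ' : E'} {v : V} {t₀ : ℝ}
    (hγ : ∀ᶠ t in 𝓝 t₀, γ t = L (ξ t) + U (ξ t, t)) (hξ : HasDerivAt ξ ξ' t₀)
    (hU : HasFDerivAt U U' (ξ t₀, t₀)) (hv : HasDerivAt γ v t₀) :
    (LinearMap.range ((L : E' →ₗ[ℝ] V) +
        (U' : E' × ℝ →ₗ[ℝ] V) ∘ₗ LinearMap.inl ℝ E' ℝ))ᗮ.starProjection v =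
      (LinearMap.range ((L : E' →ₗ[ℝ] V) +
        (U' : E' × ℝ →ₗ[ℝ] V) ∘ₗ LinearMap.inl ℝ E' ℝ))ᗮ.starProjection (U' (0, 1)) := by
  set T := LinearMap.range ((L : E' →ₗ[ℝ] V) + (U' : E' × ℝ →ₗ[ℝ] V) ∘ₗ LinearMap.inl ℝ E' ℝ)
  have hmem := velocity_sub_vertical_mem_range L hγ hξ hU hv
  have h0 : Tᗮ.starProjection (v - U' (0, 1)) = 0 := by
    rw [starProjection_apply, (orthogonalProjectionOnto_eq_zero_iff).2
      (le_orthogonal_orthogonal T hmem), coe_zero]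
  rwa [map_sub, sub_eq_zero] at h0

omit [FiniteDimensional ℝ V] in
/-- The same when the velocity is normal to the graph: `v = P_{Tᗮ} (U'(0, 1))`.
[cite: White2005, §8.4] -/
theorem velocity_eq_starProjection_vertical (L : E' →L[ℝ] V) {U : E' × ℝ → V}
    {U' : E' × ℝ →L[ℝ] V} {γ : ℝ → V} {ξ : ℝ → E'} {ξ' : E'} {v : V} {t₀ : ℝ}
    (hγ : ∀ᶠ t in 𝓝 t₀, γ t = L (ξ t) + U (ξ t, t)) (hξ : HasDerivAt ξ ξ' t₀)
    (hU : HasFDerivAt U U' (ξ t₀, t₀)) (hv : HasDerivAt γ v t₀)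
    (hn : v ∈ (LinearMap.range ((L : E' →ₗ[ℝ] V) +
      (U' : E' × ℝ →ₗ[ℝ] V) ∘ₗ LinearMap.inl ℝ E' ℝ))ᗮ) :
    v = (LinearMap.range ((L : E' →ₗ[ℝ] V) +
      (U' : E' × ℝ →ₗ[ℝ] V) ∘ₗ LinearMap.inl ℝ E' ℝ))ᗮ.starProjection (U' (0, 1)) := by
  rw [← normalPart_velocity_eq L hγ hξ hU hv, (starProjection_eq_self_iff).2 hn]

/-- **White's velocity identity in the `K_{2,α}` convention** (p. 1505 (11)–(12)): for a linear
isometry `L : E' → V` with `K = range L`, a linear `D : E' → V` with values in `Kᗮ` (the space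
differential `Du`), `T = range (L + D)` and a vertical vector `w ∈ Kᗮ`, writing
`β = w - P_T w` for its normal part: `w = P_{Kᗮ} β - D (L† β)`. [cite: White2005, §8.4 (11)–(12)] -/
theorem vertical_eq_of_normalPart (L : E' →ₗᵢ[ℝ] V) {D : E' →L[ℝ] V}
    (hD : ∀ x, D x ∈ (LinearMap.range L.toLinearMap)ᗮ) {w : V}
    (hw : w ∈ (LinearMap.range L.toLinearMap)ᗮ) :
    w = (LinearMap.range L.toLinearMap)ᗮ.starProjection
          (w - (LinearMap.range (L.toLinearMap + (D : E' →ₗ[ℝ] V))).starProjection w) -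
        D (L.toContinuousLinearMap.adjoint
          (w - (LinearMap.range (L.toLinearMap + (D : E' →ₗ[ℝ] V))).starProjection w)) := by
  set K := LinearMap.range L.toLinearMap with hK
  set T := LinearMap.range (L.toLinearMap + (D : E' →ₗ[ℝ] V)) with hT
  -- `P_T w = L c + D c`
  obtain ⟨c, hc⟩ : ∃ c : E', L c + D c = T.starProjection w := by
    obtain ⟨c, hc⟩ := LinearMap.mem_range.1 (starProjection_apply_mem T w)
    exact ⟨c, by simpa using hc⟩
  set β := w - T.starProjection w with hβ
  have hβ' : β = w - L c - D c := by rw [hβ, ← hc]; abel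
  have hLc : L c ∈ K := ⟨c, rfl⟩
  -- `P_{Kᗮ}`: kills `L c`, fixes `w` and `D c`
  have hQw : Kᗮ.starProjection w = w := (starProjection_eq_self_iff).2 hw
  have hQD : Kᗮ.starProjection (D c) = D c := (starProjection_eq_self_iff).2 (hD c)
  have hQL : Kᗮ.starProjection (L c) = 0 := by
    rw [starProjection_apply, (orthogonalProjectionOnto_eq_zero_iff).2
      (le_orthogonal_orthogonal K hLc), coe_zero]
  -- the adjoint: `L† (L c) = c`, `L†` kills `Kᗮ`
  have hadjL : ∀ x : E', L.toContinuousLinearMap.adjoint (L x) = x := fun x => by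
    refine ext_inner_right ℝ fun z => ?_
    rw [ContinuousLinearMap.adjoint_inner_left]
    exact L.inner_map_map x z
  have hadj0 : ∀ z ∈ Kᗮ, L.toContinuousLinearMap.adjoint z = 0 := fun z hz => by
    refine ext_inner_right ℝ fun x => ?_
    rw [ContinuousLinearMap.adjoint_inner_left, inner_zero_left]
    have h := hz (L x) ⟨x, rfl⟩
    rw [real_inner_comm] at h
    exact h
  have hAβ : L.toContinuousLinearMap.adjoint β = -c := by
    rw [hβ', map_sub, map_sub, hadj0 w hw, hadjL, hadj0 _ (hD c)]; abel
  have hQβ : Kᗮ.starProjection β = w - D c := by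
    rw [hβ', map_sub, map_sub, hQw, hQL, hQD]; abel
  rw [hAβ, hQβ, map_neg]
  abel

end Literature.Geometry.Riemannian
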